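import Summits.QuantumFields.YangMills.Theorems.BalabanUVNodesN15SiteCurvedDressedSizes
import Summits.QuantumFields.YangMills.Theorems.BalabanUVNodesN15SiteCurvedDressedDefect
import Summits.QuantumFields.YangMills.Theorems.BalabanUVNodesN15SiteColouredWords
import Summits.QuantumFields.YangMills.Theorems.BalabanUVNodesN15KingModelRung
import HarnessLib

/-!
# Route «BalabanUVNodes», cluster K4 «SpineRates» — node N15 = NE2: THE SITE LAYER WITH THE BACKGROUND LIVE IN THE TwoGrid ENTRY CURRENCY, XXXIII — THE COLOURED SITE LAYER DRESSED
# BY THE GENUINE ADJOINT TRANSPORTERS: `NE2PlusSite` BY NAME, EVERY COLOUR ENTRY, for the one-step King family whose dressed coloured layer is dag-n15-w3's curved pair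
# `pr₀X̂ = pr₀(1 − ĜV̂(S))⁻¹Ĝ` of the MASSLESS coloured site propagator `G′ ⊗ 1` at `S = e^{η′ ad A′} = Ad(e^{η′A′})` — the EXACT transporter of a small, slowly varying `𝔲(N)`
# potential `A′` in the (3.35) window (no linearisation of `R(U_b)`; parts XXIV∕XXVIII dressed by the first-order species `ad A′`)

Cell `pub-ymgap`, WIDTH SEAT `pub-ymgap-dag-n15-w1` (generation 4; director-ym №197 ∕ HUMAN RULING D-0149; chair R455 (A) ∕ R461; dag-lead KEY MAP v2 INBOX l.35754; sequel (3) of CLAIM-1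
l.37310).  `bears_on: R4∕N15 · K3⁸ SpineGivenEndpointR13SepCoPHV (stmt-QuantumFields-27366; K3⁷ 20544 aside = lineage)`.  Filed `--supports stmt-QuantumFields-27366 --as helper` —
COUNT-NEUTRAL.  Plumbing `def`s (the window carriers `curvBgF∕curvBgC`, the η-pairing `curvPairing`, the dressed layers `curvXfo∕curvXco`, the perturbation matrices `curvPf∕curvPc`), the
rest theorems; 0 `sorry`.  Imports BY NAME this seat's parts XXXI `…N15SiteCurvedDressedSizes` (`uN_curvDressed_sizes_massRange_coarse∕_fine`), XXXII `…N15SiteCurvedDressedDefect`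
(`uN_hasMaj_idef_curvDressed_kingTorus_king_field_closed_massRange`), XXX `…N15SiteCurvedKnitMassless` (`kingFullProp_layer_backward_massRange`), XXII `…N15SiteColouredWords`
(`siteLettersC_of_sizedDressedLetters`, `siteEntriesC`, `sitePertC`; through it XXI `cSiteExOn`, `ne2PlusSite_cSiteExOn_of_sizedLetters`), dag-n15-e's `…KingModelRung` (`KingVolIndex`),
n15-b's `opGeo`∕`fineGeo`∕`hasMaj_projO_comp`∕`idef_projO_comp`, dag-n15-w3's `blockMeanField`, dag-n15-e's Ω-b dictionary; nothing in the tree is modified.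

WHY.  Parts XXI–XXIX: the coloured site layer with the background live, dressed by the FIRST-ORDER species `ad A′` (the linearisation of [Balaban1985BackgroundPropagators] (3.50)'s
transporter `R(U′_b) = Ad(e^{η′A′(b)})`).  Parts XXX–XXXII took dag-n15-w3's EXACT curved dressing (transporter form of (3.53), all orders in `A′`) of King's propagator `⊗ 1` to the
massless endpoint with its six sized letters.  THIS FILE assembles them on the one-step King family indexed by dag-n15-e's `KingVolIndex` (cube `2L^m`, `K ≥ 1` coarse levels, size datum
`Msz ≥ 1`): fine backgrounds = skew-Hermitian potentials `A′` on the fine torus `Tor (fine L (fine (L^K) M))` whose (3.35) window at `(c₃₅, α₀)` IS the three small-field letters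
`‖A′‖, η′⁻¹‖∇A′‖, η′⁻¹‖∇∇A′‖ ≤ c₃₅·(Msz·α₀)` («|A| < O(1)Mα₀ξ⁻¹, |∇^ηA| < O(1)Mα₀ξ⁻²» read on the unit-scale torus); coarse potential = block mean (the pairing's `avg`); dressed layers
`curvXfo U = pr₀ ∘ curvDressed(η′, e^{η′ ad A′}, G′₁ ⊗ 1)`, `curvXco V = pr₀ ∘ curvDressed(η, e^{η ad V}, G′ ⊗ 1)` at `m² = 0`; part XXII turns the six letters into part XXI's three
perturbation letters, part XXI gives `NE2PlusSite` for EVERY colour entry of `((Q′G′²Q′* ⊗ 1)_{fine} + P_f(U))⁻¹ − ((Q′G′²Q′* ⊗ 1)_{coarse} + P_c(Ū))⁻¹`.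

CONTENTS.  §1 data (`curvCube`, `curvBgF`, `curvBgC`, `curvPairing`, `curvXfo`, `curvXco`, `curvPf`, `curvPc`); §2 `card_fibre_liftMap_blockOf`, `blockMeanField_adCLM`, `curvXco_avg` (the
coarse dressed layer at the block-mean potential IS parts XXX–XXXII's coarse object); §3 ★★ `curvSite_letters` (part XXII's `hL` for this family: ONE `(β, B, ε, m, m₀, δ, a₁)`,
rate exponent `¼`); §4 ★★★ `ne2PlusSite_curvColSite` (`NE2PlusSite d′ p c₃₅` for every colour selector pair), `curvInstance_gf_M` (the size-guard letter `gf.M = Msz`).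

HONEST FRAMING ∕ LIMITS.  Count-neutral KNIT of LANDED theorems; no new estimate.  MODEL-LEVEL: King's `A = 0` massless site propagator (periodic b.c., `U ≡ 1` averaging `Q`) dressed by the exact
adjoint transporter of a small potential on ONE blocking step, coarse potential = block mean (not Bałaban's (3.8)), King's torus pairing; the `U ≡ 1` site form inside `siteExC` is `qggqRe (L·L^K)`
(the dictionary with `siteForm₀` of `G′₁ ⊗ 1` on the NESTED fine torus = part VII §4 through Ω-b's cast — typed in the sequel part XXXV `…N15SiteCurvedColouredDictionary`, not here).  NOT
Bałaban's `G(U)` at a (3.35)-regular `U` of the datum with parallel-transported averaging; nothing of [B5]∕[B6]∕[B9] asserted ((3.35)–(3.37) p. 396, Thm 3.2 (3.48) p. 398, (3.50)–(3.53) p. 400,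
(3.63)–(3.67) pp. 402–403 = SHAPES ∕ MECHANISM; [King1986] p. 664, (4.1)–(4.5) p. 670 = TEMPLATE).  The OPERATOR and UNIT layers of this family are NOT typed (no `N15At` ∕ `Live` bundle for it).
NE2⁺ NOT PRINTED ∕ NOT proved for d = 4; **N15 is NOT discharged**; K3⁸ OPEN, not claimed, skeleton v6 untouched (its N15 pin is `fullGSizedObjects`; nothing here is a re-pin); counts of record
UNMOVED (typed 28∕28 · discharged 5∕27, A 5∕28); one finite four-torus programme at fixed `ε` — NOT ℝ⁴, NOT infinite volume, NOT OS, NOT a mass gap, NOT Clay; R4 closes the conditional finite-𝕋⁴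
rung `BalabanLadder.UV` only.  Restate-immune (no Theses import).
-/

set_option autoImplicit false

noncomputable section
open scoped BigOperators Matrix Matrix.Norms.Frobenius

namespace Summit.QuantumFields.YangMills.BalabanUVNodes.N15.SiteLayerBg

open Real Finset NormedSpace
open Literature.MathematicalPhysics.QuantumFieldTheory.Balaban1983to89
open Literature.MathematicalPhysics.QuantumFieldTheory.Balaban1983to89.B11SectG (BlockNorm HasMaj RowSum)
open Literature.MathematicalPhysics.QuantumFieldTheory.Balaban1983to89.T4EtaRate (PairedInstance EtaPairing NE2PlusSite)
open Literature.MathematicalPhysics.QuantumFieldTheory.Balaban1983to89.T4EtaRateDefect (idef idef_apply idef_comp)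
open Literature.MathematicalPhysics.QuantumFieldTheory.Balaban1983to89.T4EtaRateCoeffDefect (pull pull_apply fibre mem_fibre)
open Literature.MathematicalPhysics.QuantumFieldTheory.Balaban1983to89.B5Prop11Plancherel (Tor fine unitVec)
open Literature.MathematicalPhysics.QuantumFieldTheory.Balaban1983to89.B6UnitTorusCarrier (card_fibre_blockOf)
open Literature.MathematicalPhysics.QuantumFieldTheory.King1986 (aK aK_pos)
open Literature.MathematicalPhysics.QuantumFieldTheory.King1986.Torus (fineOp blockOf tdistT tdistT_nonneg site)
open Literature.MathematicalPhysics.QuantumFieldTheory.Balaban1983to89.B4Sect5Torus (tdist)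
open Literature.MathematicalPhysics.QuantumFieldTheory.Balaban1983to89.B5QGGQ145Bounds (Idx)
open Literature.MathematicalPhysics.QuantumFieldTheory.Balaban1983to89.Beta.AveragingCorrectionJets (adCLM adCLM_eq_adL adL)
open Literature.Barriers.QuantumFields (traceForm)
open Summit.QuantumFields.YangMills.BalabanUVNodes.N15.VectorPiece (unitTorusGeoS tensorId tensorId_apply hasMaj_tensorId idef_tensorId)
open Summit.QuantumFields.YangMills.BalabanUVNodes.N15.MatrixSpecies (liftMap liftBlk liftEquiv coordMat basisConst)
open Summit.QuantumFields.YangMills.BalabanUVNodes.N15.BackgroundLayer (liftPair blkPair projO fineGeo hasMaj_projO_comp idef_projO_comp abs_le_iSup_abs)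
open Summit.QuantumFields.YangMills.BalabanUVNodes.N15.OperatorReadout (opGeo)
open Summit.QuantumFields.YangMills.BalabanUVNodes.N15.CurvedSpecies (torStep blockMeanField blockMeanTV curvDressed expTrField)
open Summit.QuantumFields.YangMills.BalabanUVNodes.N15KingModelRung (KingVolIndex)
open Summit.QuantumFields.YangMills.BalabanUVNodes.N15KingModelRung.Curved

variable {d : ℕ} (L : ℕ) [NeZero L]
variable {n : Type} [Fintype n] [DecidableEq n] (κ : Type) [Fintype κ] [DecidableEq κ] (e : Matrix n n ℂ ≃L[ℝ] (κ → ℝ)) (a : ℝ)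

/-! ## §1 The one-step King family with potential windows: carriers, pairing, dressed layers, perturbation matrices -/

section Data

/-- The cube `M_μ = 2L^m` of an index. [cite: Balaban1987RG1, (0.1) p.251 (volumes 2L^m)] -/
abbrev curvCube (i : KingVolIndex d) : Fin (d + 1) → ℕ := fun _ => 2 * L ^ i.m

/-- **THE FINE BACKGROUNDS: POTENTIALS IN THE (3.35) WINDOW.**  Configurations = `𝔲(N)`-valued lattice gauge potentials `A′` on the fine torus `Tor (fine L (fine (L^K) M))` (spacing
`η′ = L^{−(K+1)}` inside the unit-scale torus); `Reg335 c₃₅ α₀ A′` := skew-Hermitian values AND the three small-field letters `‖A′_μ(y′)‖ ≤ c₃₅(M_sz α₀)`, `‖A′_μ(y′) − A′_μ(y′ − e_ν)‖ ≤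
η′c₃₅(M_sz α₀)`, `‖η′⁻¹(∇_ν∇_μA′)‖ ≤ η′c₃₅(M_sz α₀)` — the print's «U^u = e^{iηA}, |A| < O(1)Mα₀(L^jη)⁻¹, |∇^ηA| < O(1)Mα₀(L^jη)⁻²» read on the unit-scale torus (the (3.36) slot repeats
the skew-Hermitian + size letters only; the complex classes (3.37)∕(3.38) are not used by the site layer; only `Reg335` is read by `NE2PlusSite`). [cite: Balaban1985BackgroundPropagators, (3.35)–(3.36) p.396] -/
def curvBgF (n : Type) [Fintype n] [DecidableEq n] (i : KingVolIndex d) : B9.Backgrounds where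
  Cfg := Fin (d + 1) → Tor (fine L (fine (L ^ i.K) (curvCube L i))) → Matrix n n ℂ
  one := 0
  mul := fun A B => A + B
  Reg335 := fun c35 α₀ A' => (∀ μ y', (A' μ y')ᴴ = -A' μ y') ∧ (∀ μ y', ‖A' μ y'‖ ≤ c35 * (i.Msz * α₀)) ∧
    (∀ μ ν y', ‖A' μ y' - A' μ (y' - unitVec (fine L (fine (L ^ i.K) (curvCube L i))) ν)‖ ≤ ((L : ℝ) ^ (i.K + 1))⁻¹ * (c35 * (i.Msz * α₀))) ∧
    (∀ μ ν (z' : Tor (fine L (fine (L ^ i.K) (curvCube L i)))),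
      ‖(((L : ℝ) ^ (i.K + 1))⁻¹)⁻¹ • (A' μ (z' + unitVec (fine L (fine (L ^ i.K) (curvCube L i))) ν + unitVec (fine L (fine (L ^ i.K) (curvCube L i))) μ) -
          A' μ (z' + unitVec (fine L (fine (L ^ i.K) (curvCube L i))) ν)) -
        (((L : ℝ) ^ (i.K + 1))⁻¹)⁻¹ • (A' μ (z' + unitVec (fine L (fine (L ^ i.K) (curvCube L i))) μ) - A' μ z')‖ ≤ ((L : ℝ) ^ (i.K + 1))⁻¹ * (c35 * (i.Msz * α₀)))
  Reg336 := fun c35 α₀ A' => (∀ μ y', (A' μ y')ᴴ = -A' μ y') ∧ (∀ μ y', ‖A' μ y'‖ ≤ c35 * (i.Msz * α₀))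
  Cplx337 := fun _ _ _ => True
  Cplx338 := fun _ _ _ => True

/-- THE COARSE BACKGROUNDS: potentials on the coarse torus `Tor (fine (L^K) M)` (the block means of the fine ones); its windows are inert for the site layer (only the fine window is
quantified in `NE2PlusSite`). [cite: Balaban1985BackgroundPropagators, (3.35) p.396 (shape)] -/
def curvBgC (n : Type) [Fintype n] [DecidableEq n] (i : KingVolIndex d) : B9.Backgrounds where
  Cfg := Fin (d + 1) → Tor (fine (L ^ i.K) (curvCube L i)) → Matrix n n ℂ
  one := 0
  mul := fun A B => A + B
  Reg335 := fun c35 α₀ V => (∀ μ y, (V μ y)ᴴ = -V μ y) ∧ (∀ μ y, ‖V μ y‖ ≤ c35 * (i.Msz * α₀))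
  Reg336 := fun c35 α₀ V => (∀ μ y, (V μ y)ᴴ = -V μ y) ∧ (∀ μ y, ‖V μ y‖ ≤ c35 * (i.Msz * α₀))
  Cplx337 := fun _ _ _ => True
  Cplx338 := fun _ _ _ => True

/-- **THE η-PAIRING OF THE ONE-STEP KING FAMILY WITH POTENTIALS** (NOT PRINTED data, as every `EtaPairing`): operator geometry = the sized unit-torus carrier read on the coloured coarse
run `Tor (fine (L^K) M) × κ` (blocks `blockOf (L^K)`), fine geometry one scale finer on `Tor (fine L (fine (L^K) M)) × κ` (blocks `blockOf (L^K) ∘ blockOf L`), test functions pulled back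
along King's pairing, background transport = the BLOCK MEAN of the potential (the lineage's model of the averaging). [cite: King1986, p.664 (pairing convention)] -/
def curvPairing (i : KingVolIndex d) :
    EtaPairing (opGeo (unitTorusGeoS L i.K (curvCube L i) i.Msz) (Tor (fine (L ^ i.K) (curvCube L i)) × κ) (liftBlk (blockOf (L ^ i.K) (curvCube L i)) κ))
      (fineGeo (unitTorusGeoS L i.K (curvCube L i) i.Msz) (Tor (fine L (fine (L ^ i.K) (curvCube L i))) × κ)
        (liftBlk (blockOf (L ^ i.K) (curvCube L i) ∘ blockOf L (fine (L ^ i.K) (curvCube L i))) κ) 1)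
      (curvBgC L n i) (curvBgF L n i) where
  n := 1
  k_eq := rfl
  L_eq := rfl
  M_eq := rfl
  eta_eq := by
    show (((L : ℝ) ^ i.K)⁻¹ * ((L : ℝ) ^ 1)⁻¹) * (L : ℝ) ^ 1 = ((L : ℝ) ^ i.K)⁻¹
    rw [mul_assoc, inv_mul_cancel₀ (pow_ne_zero _ (Nat.cast_ne_zero.mpr (NeZero.ne L))), mul_one]
  ι := fun y => y
  scale_ι := fun _ => rfl
  dist_ι := fun _ _ => rfl
  τ := fun lam => pull (liftMap (blockOf L (fine (L ^ i.K) (curvCube L i))) κ) lam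
  suppIn_τ := fun _ _ h x' hx' => h (liftMap (blockOf L (fine (L ^ i.K) (curvCube L i))) κ x') hx'
  supNorm_τ := fun lam => by
    show (⨆ x' : Tor (fine L (fine (L ^ i.K) (curvCube L i))) × κ, |lam (liftMap (blockOf L (fine (L ^ i.K) (curvCube L i))) κ x')|) ≤
      ⨆ x : Tor (fine (L ^ i.K) (curvCube L i)) × κ, |lam x|
    exact Real.iSup_le (fun x' => abs_le_iSup_abs lam _) (Real.iSup_nonneg fun x => abs_nonneg _)
  avg := fun A' => blockMeanField L (fine (L ^ i.K) (curvCube L i)) A'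
  avg_one := blockMeanField_zero L (fine (L ^ i.K) (curvCube L i))

/-- **THE FINE DRESSED LAYER** `X′(A′) = pr₀ ∘ curvDressed(η′, e^{η′ ad A′}; G′₁ ⊗ 1)`: the massless coloured site propagator of the fine run dressed by the EXACT adjoint transporters
`Ad(e^{η′A′(x)})` (dag-n15-w2 p596957), flat base point. [cite: Balaban1985BackgroundPropagators, (3.50)–(3.53) p.400, (3.63)–(3.65) pp.402–403 (mechanism)] -/
def curvXfo (i : KingVolIndex d) (A' : (curvBgF L n i).Cfg) :
    (Tor (fine L (fine (L ^ i.K) (curvCube L i))) × κ → ℝ) →ₗ[ℝ] (Tor (fine L (fine (L ^ i.K) (curvCube L i))) × κ → ℝ) :=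
  projO (none : Option (Fin (d + 1) ⊕ Fin (d + 1))) ∘ₗ
    curvDressed ((L : ℝ) ^ (i.K + 1))⁻¹ (torStep (fine L (fine (L ^ i.K) (curvCube L i)))) (expTrField e ((L : ℝ) ^ (i.K + 1))⁻¹ 0)
      (expTrField e ((L : ℝ) ^ (i.K + 1))⁻¹ (fun μ y' => adCLM ℝ (A' μ y'))) (kingGT₁ L a 0 i.K (curvCube L i) κ)

/-- **THE COARSE DRESSED LAYER** `X(V) = pr₀ ∘ curvDressed(η, e^{η ad V}; G′ ⊗ 1)`, `η = L·η′`. [cite: Balaban1985BackgroundPropagators, (3.50)–(3.53) p.400, (3.63)–(3.65) pp.402–403 (mechanism)] -/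
def curvXco (i : KingVolIndex d) (V : (curvBgC L n i).Cfg) :
    (Tor (fine (L ^ i.K) (curvCube L i)) × κ → ℝ) →ₗ[ℝ] (Tor (fine (L ^ i.K) (curvCube L i)) × κ → ℝ) :=
  projO (none : Option (Fin (d + 1) ⊕ Fin (d + 1))) ∘ₗ
    curvDressed ((L : ℝ) * ((L : ℝ) ^ (i.K + 1))⁻¹) (torStep (fine (L ^ i.K) (curvCube L i))) (expTrField e ((L : ℝ) * ((L : ℝ) ^ (i.K + 1))⁻¹) 0)
      (expTrField e ((L : ℝ) * ((L : ℝ) ^ (i.K + 1))⁻¹) (fun μ y => adCLM ℝ (V μ y))) (kingGT L a 0 i.K (curvCube L i) κ)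

/-- THE FINE (3.65) SITE PERTURBATION MATRIX `P_f(U)` on `Idx M × κ`: part XXII's `siteEntriesC (sitePertC (q ∘ π) (G′₁ ⊗ 1) X′(U))`. [cite: Balaban1985BackgroundPropagators, (3.65) p.403 (shape)] -/
def curvPf (i : KingVolIndex d) (A' : (curvBgF L n i).Cfg) : Matrix (Idx (curvCube L i) × κ) (Idx (curvCube L i) × κ) ℝ :=
  siteEntriesC (curvCube L i) κ (sitePertC (curvCube L i) κ (liftMap (blockOf (L ^ i.K) (curvCube L i) ∘ blockOf L (fine (L ^ i.K) (curvCube L i))) κ)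
    (kingGT₁ L a 0 i.K (curvCube L i) κ) (curvXfo L κ e a i A'))

/-- THE COARSE (3.65) SITE PERTURBATION MATRIX `P_c(V)`. [cite: Balaban1985BackgroundPropagators, (3.65) p.403 (shape)] -/
def curvPc (i : KingVolIndex d) (V : (curvBgC L n i).Cfg) : Matrix (Idx (curvCube L i) × κ) (Idx (curvCube L i) × κ) ℝ :=
  siteEntriesC (curvCube L i) κ (sitePertC (curvCube L i) κ (liftMap (blockOf (L ^ i.K) (curvCube L i)) κ) (kingGT L a 0 i.K (curvCube L i) κ) (curvXco L κ e a i V))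

end Data

/-! ## §2 Fibres of the colour-lifted pairing; the block mean commutes with `ad`; the coarse layer at the averaged potential -/

section Lemmas

/-- The colour-lifted one-step King pairing has uniform fibres `L^{d+1}`. [folklore] -/
theorem card_fibre_liftMap_blockOf (N : Fin (d + 1) → ℕ) [∀ μ, NeZero (N μ)] :
    ∃ Nf : ℕ, Nf ≠ 0 ∧ ∀ p : Tor N × κ, (fibre (liftMap (blockOf L N) κ) p).card = Nf := by
  classical
  refine ⟨L ^ (d + 1), pow_ne_zero _ (NeZero.ne L), fun p => ?_⟩
  rw [← card_fibre_blockOf L N p.1]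
  refine Finset.card_bij (fun q _ => q.1) (fun q hq => ?_) (fun q₁ hq₁ q₂ hq₂ h => ?_) (fun x' hx' => ?_)
  · exact (mem_fibre (blockOf L N) p.1 q.1).2 (congrArg Prod.fst ((mem_fibre (liftMap (blockOf L N) κ) p q).1 hq))
  · have e1 : q₁.2 = p.2 := congrArg Prod.snd ((mem_fibre (liftMap (blockOf L N) κ) p q₁).1 hq₁)
    have e2 : q₂.2 = p.2 := congrArg Prod.snd ((mem_fibre (liftMap (blockOf L N) κ) p q₂).1 hq₂)
    exact Prod.ext h (e1.trans e2.symm)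
  · exact ⟨(x', p.2), (mem_fibre (liftMap (blockOf L N) κ) p (x', p.2)).2 (Prod.ext ((mem_fibre (blockOf L N) p.1 x').1 hx') rfl), rfl⟩

omit [NeZero L] in
/-- THE BLOCK MEAN COMMUTES WITH `ad` (`ad` is linear): `blockMean(ad ∘ A′) = ad ∘ blockMean(A′)`. [folklore] -/
theorem blockMeanField_adCLM (N : Fin (d + 1) → ℕ) [∀ μ, NeZero (N μ)] (A' : Fin (d + 1) → Tor (fine L N) → Matrix n n ℂ) :
    blockMeanField L N (fun μ y' => adCLM ℝ (A' μ y')) = fun μ b => adCLM ℝ (blockMeanField L N A' μ b) := by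
  funext μ b
  simp only [blockMeanField, blockMeanTV, adCLM_eq_adL, map_smul, map_sum]

/-- **THE COARSE DRESSED LAYER AT THE AVERAGED POTENTIAL IS PARTS XXX–XXXII's COARSE OBJECT** (`blockMean 0 = 0`, `blockMean(ad ∘ A′) = ad ∘ blockMean A′`). [folklore] -/
theorem curvXco_avg (i : KingVolIndex d) (A' : (curvBgF L n i).Cfg) :
    curvXco L κ e a i ((curvPairing L κ i).avg A') = projO (none : Option (Fin (d + 1) ⊕ Fin (d + 1))) ∘ₗ
      curvDressed ((L : ℝ) * ((L : ℝ) ^ (i.K + 1))⁻¹) (torStep (fine (L ^ i.K) (curvCube L i)))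
        (expTrField e ((L : ℝ) * ((L : ℝ) ^ (i.K + 1))⁻¹) (blockMeanField L (fine (L ^ i.K) (curvCube L i)) 0))
        (expTrField e ((L : ℝ) * ((L : ℝ) ^ (i.K + 1))⁻¹) (blockMeanField L (fine (L ^ i.K) (curvCube L i)) (fun μ y' => adCLM ℝ (A' μ y'))))
        (kingGT L a 0 i.K (curvCube L i) κ) := by
  rw [blockMeanField_zero, blockMeanField_adCLM]
  rfl

end Lemmas

/-! ## §3 ★★ Part XXII's three perturbation letters for the curved-dressed family -/

section Letters

/-- nonnegative-exponent bookkeeping: `(L^K)^{−½} ≤ (L^K)^{−¼}` and `(L^K)^{−¼} + (L^K)^{−½} ≤ 2(L^K)^{−¼}` (`L ≥ 1`). [folklore] -/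
theorem theta_le_two_rpow {L : ℕ} (hL : 1 ≤ L) (K : ℕ) :
    ((L : ℝ) ^ K) ^ (-(1 / 2 / 2 : ℝ)) + ((L : ℝ) ^ K) ^ (-(1 / 2 : ℝ)) ≤ 2 * ((L : ℝ) ^ K) ^ (-(1 / 4 : ℝ)) := by
  have hL1 : (1 : ℝ) ≤ (L : ℝ) ^ K := one_le_pow₀ (by exact_mod_cast hL)
  have h1 : ((L : ℝ) ^ K) ^ (-(1 / 2 : ℝ)) ≤ ((L : ℝ) ^ K) ^ (-(1 / 4 : ℝ)) := Real.rpow_le_rpow_of_exponent_le hL1 (by norm_num)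
  have h2 : ((L : ℝ) ^ K) ^ (-(1 / 2 / 2 : ℝ)) = ((L : ℝ) ^ K) ^ (-(1 / 4 : ℝ)) := by norm_num
  rw [h2]; linarith

/-- ★★ **PART XXII's THREE SIZED PERTURBATION LETTERS FOR THE CURVED-DRESSED COLOURED SITE LAYER** (`siteLettersC_of_sizedDressedLetters` fed: the `U ≡ 1` layers `G′ ⊗ 1 = kingGT … 0`,
`G′₁ ⊗ 1 = kingGT₁ … 0` with part XXX's massless letters read through `tensorId`∕`castT`; the dressed layers `curvXco∕curvXfo` with parts XXXI (sizes, increments LINEAR in `c₃₅·(M_sz·α₀)`)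
and XXXII (defect, `none` row by `idef_projO_comp` + `hasMaj_projO_comp`); uniform fibres `L^{d+1}`): `∃ δ_P ζ τ a₁ > 0` such that for every index, `α₀ > 0` with `M_sz·α₀ ≤ a₁` and every
`A′` in the window `Reg335 c₃₅ α₀`: `|P_c(Ā′)|, |P_f(A′)| ≤ ζ(M_sz α₀)e^{−δ_P·tdist}` and `|P_f(A′) − P_c(Ā′)| ≤ τ(L^K)^{−¼}e^{−δ_P·tdist}` on `Idx M × κ`.
[cite: Balaban1985BackgroundPropagators, (3.35) p.396, Thm 3.2 (3.48) p.398, (3.63)–(3.67) pp.402–403 (mechanism); King1986, p.664 (pairing), (4.1)–(4.5) p.670] -/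
theorem curvSite_letters (he : ∀ X Y : Matrix n n ℂ, traceForm X Y = e X ⬝ᵥ e Y) (hLodd : Odd L) (hL : 2 ≤ L) (ha : 0 < a) (c35 : ℝ) :
    ∃ δP ζ τ a₁ : ℝ, 0 < δP ∧ 0 < ζ ∧ 0 < τ ∧ 0 < a₁ ∧
      ∀ (i : KingVolIndex d) (α₀ : ℝ), 0 < α₀ → i.Msz * α₀ ≤ a₁ → ∀ U : (curvBgF L n i).Cfg, (curvBgF L n i).Reg335 c35 α₀ U →
        (∀ p p' : Idx (curvCube L i) × κ, |curvPc L κ e a i ((curvPairing L κ i).avg U) p p'| ≤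
            ζ * (i.Msz * α₀) * Real.exp (-(δP * tdist (curvCube L i) p.1 p'.1))) ∧
        (∀ p p' : Idx (curvCube L i) × κ, |curvPf L κ e a i U p p'| ≤ ζ * (i.Msz * α₀) * Real.exp (-(δP * tdist (curvCube L i) p.1 p'.1))) ∧
        (∀ p p' : Idx (curvCube L i) × κ, |curvPf L κ e a i U p p' - curvPc L κ e a i ((curvPairing L κ i).avg U) p p'| ≤
            τ * ((L : ℝ) ^ i.K) ^ (-(1 / 4 : ℝ)) * Real.exp (-(δP * tdist (curvCube L i) p.1 p'.1))) := by
  -- the four packages of uniform constants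
  obtain ⟨β₁, δ₁, m₁, hβ₁, hδ₁, hm₁, H₁⟩ := kingFullProp_layer_backward_massRange (d := d) L hLodd hL ha le_rfl (γ := 1 / 2) (by norm_num) (by norm_num) (α := 1 / 2)
    (by norm_num) (by norm_num)
  obtain ⟨δ₂, B₂, E₂, t₂, hδ₂, hB₂, hE₂, ht₂, H₂⟩ := uN_curvDressed_sizes_massRange_coarse (d := d) L e he hLodd hL ha le_rfl
  obtain ⟨δ₃, B₃, E₃, t₃, hδ₃, hB₃, hE₃, ht₃, H₃⟩ := uN_curvDressed_sizes_massRange_fine (d := d) L e he hLodd hL ha le_rfl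
  obtain ⟨δ₄, C₄, a₄, hδ₄, hC₄, ha₄, H₄⟩ := uN_hasMaj_idef_curvDressed_kingTorus_king_field_closed_massRange (d := d) L e he hLodd hL ha le_rfl (γ := 1 / 2) (by norm_num)
    (by norm_num) (α := 1 / 2) (by norm_num) (by norm_num)
  have hL1 : 1 ≤ L := by omega
  have hLr : (0 : ℝ) ≤ (L : ℝ) := Nat.cast_nonneg _
  -- ONE set of constants
  set δ : ℝ := min (min δ₁ (δ₂ / 2)) (min (δ₃ / 2) (δ₄ / 2)) with hδdef
  have hδ : 0 < δ := lt_min (lt_min hδ₁ (half_pos hδ₂)) (lt_min (half_pos hδ₃) (half_pos hδ₄))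
  have hdδ₁ : δ ≤ δ₁ := (min_le_left _ _).trans (min_le_left _ _)
  have hdδ₂ : δ ≤ δ₂ / 2 := (min_le_left _ _).trans (min_le_right _ _)
  have hdδ₃ : δ ≤ δ₃ / 2 := (min_le_right _ _).trans (min_le_left _ _)
  have hdδ₄ : δ ≤ δ₄ / 2 := (min_le_right _ _).trans (min_le_right _ _)
  set cp : ℝ := max c35 0 with hcdef
  have hcp : 0 ≤ cp := le_max_right _ _
  have hcpc : c35 ≤ cp := le_max_left _ _
  set a₁ : ℝ := min (min t₂ t₃) a₄ / (cp + 1) with ha₁def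
  have ha₁ : 0 < a₁ := div_pos (lt_min (lt_min ht₂ ht₃) ha₄) (by linarith)
  refine siteLettersC_of_sizedDressedLetters (L := L) (I := KingVolIndex d) κ (fun i => curvCube L i) (fun i => i.K) (fun i => i.Msz)
    (fun i => Tor (fine (L ^ i.K) (curvCube L i)) × κ) (fun i => Tor (fine L (fine (L ^ i.K) (curvCube L i))) × κ)
    (fun i => liftMap (blockOf (L ^ i.K) (curvCube L i)) κ) (fun i => liftMap (blockOf L (fine (L ^ i.K) (curvCube L i))) κ) (curvBgC L n) (curvBgF L n)
    (fun i => (curvPairing L κ i).avg) (fun i => kingGT L a 0 i.K (curvCube L i) κ) (fun i => kingGT₁ L a 0 i.K (curvCube L i) κ) (curvXco L κ e a) (curvXfo L κ e a) c35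
    (γP := 1 / 4) (fun i => le_trans zero_le_one i.one_le_Msz) (fun i => card_fibre_liftMap_blockOf L κ _)
    ⟨β₁, max B₂ B₃, (E₂ + E₃) * cp + 1, 2 * C₄, 2 * m₁, δ, a₁, hβ₁.le, le_max_of_le_left hB₂.le, by positivity, by positivity, by positivity, hδ, ha₁, fun i => ?_⟩
  -- per index: the carrier facts and the `U ≡ 1` letters (part XXX §1 at `m² = 0`, `n = 1`, read through `tensorId` ∕ `castT` as in Ω-c)
  have HK := fun μ : Fin (d + 1) => H₁ i.K i.one_le_K 1 le_rfl i.m (curvCube L i) (fun _ => rfl) 0 le_rfl le_rfl i.Msz μ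
  have maj0 : ∀ y y' : Tor (curvCube L i), 0 ≤ β₁ * Real.exp (-(δ₁ * tdistT (curvCube L i) y y')) := fun _ _ => by positivity
  have hθ0 : 0 ≤ ((L : ℝ) ^ i.K) ^ (-(1 / 2 / 2 : ℝ)) + ((L : ℝ) ^ i.K) ^ (-(1 / 2 : ℝ)) :=
    add_nonneg (Real.rpow_nonneg (pow_nonneg hLr _) _) (Real.rpow_nonneg (pow_nonneg hLr _) _)
  have hθ := theta_le_two_rpow hL1 i.K
  have majm : ∀ y y' : Tor (curvCube L i), 0 ≤ m₁ * (((L : ℝ) ^ i.K) ^ (-(1 / 2 / 2 : ℝ)) + ((L : ℝ) ^ i.K) ^ (-(1 / 2 : ℝ))) * Real.exp (-(δ₁ * tdistT (curvCube L i) y y')) :=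
    fun _ _ => mul_nonneg (mul_nonneg hm₁.le hθ0) (Real.exp_nonneg _)
  have hG : HasMaj (BlockNorm.ofBlocks (unitTorusGeoS L i.K (curvCube L i) i.Msz) (liftBlk (blockOf (L ^ i.K) (curvCube L i)) κ))
      (BlockNorm.ofBlocks (unitTorusGeoS L i.K (curvCube L i) i.Msz) (liftBlk (blockOf (L ^ i.K) (curvCube L i)) κ)) (kingGT L a 0 i.K (curvCube L i) κ)
      (fun y y' => β₁ * Real.exp (-(δ₁ * tdistT (curvCube L i) y y'))) :=
    hasMaj_tensorId κ maj0 (HK 0).1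
  have hG' : HasMaj (BlockNorm.ofBlocks (unitTorusGeoS L i.K (curvCube L i) i.Msz) (liftBlk (blockOf (L ^ i.K) (curvCube L i) ∘ blockOf L (fine (L ^ i.K) (curvCube L i))) κ))
      (BlockNorm.ofBlocks (unitTorusGeoS L i.K (curvCube L i) i.Msz) (liftBlk (blockOf (L ^ i.K) (curvCube L i) ∘ blockOf L (fine (L ^ i.K) (curvCube L i))) κ))
      (kingGT₁ L a 0 i.K (curvCube L i) κ) (fun y y' => β₁ * Real.exp (-(δ₁ * tdistT (curvCube L i) y y'))) := by
    refine hasMaj_tensorId κ maj0 ?_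
    rw [blockOf_comp_blockOf_eq]
    exact hasMaj_conjEquiv _ _ (castT L i.K (curvCube L i)) maj0 (HK 0).2.2.2.1
  have hDG : HasMaj (BlockNorm.ofBlocks (unitTorusGeoS L i.K (curvCube L i) i.Msz) (liftBlk (blockOf (L ^ i.K) (curvCube L i)) κ))
      (BlockNorm.ofBlocks (unitTorusGeoS L i.K (curvCube L i) i.Msz) (liftBlk (blockOf (L ^ i.K) (curvCube L i) ∘ blockOf L (fine (L ^ i.K) (curvCube L i))) κ))
      (idef (pull (liftMap (blockOf L (fine (L ^ i.K) (curvCube L i))) κ)) (pull (liftMap (blockOf L (fine (L ^ i.K) (curvCube L i))) κ))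
        (kingGT₁ L a 0 i.K (curvCube L i) κ) (kingGT L a 0 i.K (curvCube L i) κ))
      (fun y y' => m₁ * (((L : ℝ) ^ i.K) ^ (-(1 / 2 / 2 : ℝ)) + ((L : ℝ) ^ i.K) ^ (-(1 / 2 : ℝ))) * Real.exp (-(δ₁ * tdistT (curvCube L i) y y'))) := by
    rw [kingGT₁, kingGT, idef_tensorId]
    refine hasMaj_tensorId κ majm ?_
    rw [kingGOp₁, idef_conj_eq, blockOf_comp_blockOf_eq]
    exact hasMaj_pullEquiv_comp _ (castT L i.K (curvCube L i)) majm (HK 0).2.2.2.2.2.2.1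
  refine ⟨hasMaj_exp_weaken L hβ₁.le le_rfl hdδ₁ hG, hasMaj_exp_weaken L hβ₁.le le_rfl hdδ₁ hG', ?_, fun α₀ hα₀ hMα U hreg => ?_⟩
  · refine hasMaj_exp_weaken L (mul_nonneg hm₁.le hθ0) ?_ hdδ₁ hDG
    nlinarith [hm₁.le]
  -- inside the window: the small-field bound `t = cp·(M_sz α₀) ≤ t₂, t₃, a₄`
  obtain ⟨hskew, hA, hgradA, hsecA⟩ := hreg
  set s : ℝ := i.Msz * α₀ with hsdef
  have hs0 : 0 ≤ s := mul_nonneg (le_trans zero_le_one i.one_le_Msz) hα₀.le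
  set t : ℝ := cp * s with htdef
  have ht0 : 0 ≤ t := mul_nonneg hcp hs0
  have hct : c35 * s ≤ t := mul_le_mul_of_nonneg_right hcpc hs0
  have htmin : t ≤ min (min t₂ t₃) a₄ := by
    have h1 : t ≤ (cp + 1) * a₁ := by rw [htdef]; nlinarith [hMα]
    have h2 : (cp + 1) * a₁ = min (min t₂ t₃) a₄ := by rw [ha₁def]; field_simp
    linarith
  have htt₂ : t ≤ t₂ := htmin.trans ((min_le_left _ _).trans (min_le_left _ _))
  have htt₃ : t ≤ t₃ := htmin.trans ((min_le_left _ _).trans (min_le_right _ _))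
  have hta₄ : t ≤ a₄ := htmin.trans (min_le_right _ _)
  have hA' : ∀ μ y', ‖U μ y'‖ ≤ t := fun μ y' => (hA μ y').trans hct
  have hgradA' : ∀ μ ν y', ‖U μ y' - U μ (y' - unitVec (fine L (fine (L ^ i.K) (curvCube L i))) ν)‖ ≤ ((L : ℝ) ^ (i.K + 1))⁻¹ * t :=
    fun μ ν y' => (hgradA μ ν y').trans (mul_le_mul_of_nonneg_left hct (by positivity))
  have hsecA' : ∀ μ ν (z' : Tor (fine L (fine (L ^ i.K) (curvCube L i)))),
      ‖(((L : ℝ) ^ (i.K + 1))⁻¹)⁻¹ • (U μ (z' + unitVec (fine L (fine (L ^ i.K) (curvCube L i))) ν + unitVec (fine L (fine (L ^ i.K) (curvCube L i))) μ) -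
          U μ (z' + unitVec (fine L (fine (L ^ i.K) (curvCube L i))) ν)) -
        (((L : ℝ) ^ (i.K + 1))⁻¹)⁻¹ • (U μ (z' + unitVec (fine L (fine (L ^ i.K) (curvCube L i))) μ) - U μ z')‖ ≤ ((L : ℝ) ^ (i.K + 1))⁻¹ * t :=
    fun μ ν z' => (hsecA μ ν z').trans (mul_le_mul_of_nonneg_left hct (by positivity))
  -- the coarse and fine sizes ∕ increments (parts XXXI), read at the averaged potential through `curvXco_avg`
  obtain ⟨hXc, hEc⟩ := H₂ i.K i.one_le_K i.m (curvCube L i) (fun _ => rfl) 0 le_rfl le_rfl i.Msz U t ht0 htt₂ hA' hgradA' hskew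
  obtain ⟨hXf, hEf⟩ := H₃ i.K i.one_le_K i.m (curvCube L i) (fun _ => rfl) 0 le_rfl le_rfl i.Msz U t ht0 htt₃ hA' hgradA' hskew
  rw [← curvXco_avg] at hXc hEc
  -- the defect (part XXXII at `a₀ = a₄`), `none` row
  have hD := H₄ i.K i.one_le_K i.m (curvCube L i) (fun _ => rfl) 0 le_rfl le_rfl i.Msz U (fun μ y' => (hA' μ y').trans hta₄)
    (fun μ ν y' => (hgradA' μ ν y').trans (mul_le_mul_of_nonneg_left hta₄ (by positivity)))
    (fun μ ν z' => (hsecA' μ ν z').trans (mul_le_mul_of_nonneg_left hta₄ (by positivity))) hskew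
  have hD0 := hasMaj_projO_comp (g := unitTorusGeoS L i.K (curvCube L i) i.Msz)
    (liftBlk (blockOf (L ^ i.K) (curvCube L i) ∘ blockOf L (fine (L ^ i.K) (curvCube L i))) κ) hD none
  rw [← idef_projO_comp, ← curvXco_avg] at hD0
  -- bookkeeping of constants
  have hE : E₂ * t ≤ ((E₂ + E₃) * cp + 1) * (i.Msz * α₀) := by rw [htdef, hsdef]; nlinarith [hE₃.le, hcp, hs0]
  have hE' : E₃ * t ≤ ((E₂ + E₃) * cp + 1) * (i.Msz * α₀) := by rw [htdef, hsdef]; nlinarith [hE₂.le, hcp, hs0]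
  refine ⟨hasMaj_exp_weaken L hB₂.le (le_max_left _ _) hdδ₂ hXc, hasMaj_exp_weaken L hB₃.le (le_max_right _ _) hdδ₃ hXf,
    hasMaj_exp_weaken L (mul_nonneg hE₂.le ht0) hE hdδ₂ hEc, hasMaj_exp_weaken L (mul_nonneg hE₃.le ht0) hE' hdδ₃ hEf, ?_⟩
  refine hasMaj_exp_weaken L (mul_nonneg hC₄.le hθ0) ?_ hdδ₄ hD0
  nlinarith [hC₄.le]

end Letters

/-! ## §4 ★★★ `NE2PlusSite` by name, every colour entry -/

section Socket

/-- ★★★ **`NE2PlusSite`, EVERY COLOUR ENTRY, FOR THE COLOURED SITE LAYER DRESSED BY THE GENUINE ADJOINT TRANSPORTERS** — part XXI's socket on the one-step King family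
`pi i = ⟨opGeo (unitTorusGeoS L K (2L^m) M_sz) (Tor (fine (L^K) ·) × κ) (liftBlk blockOf κ), fineGeo … 1, curvBgC, curvBgF, curvPairing⟩` (fine window = the potential's three small-field
letters at `c₃₅·(M_sz α₀)` + skew-Hermitian values; `gf.M = M_sz` by `M_eq`, `M_sz ≥ 1` so the size guard `M₅ ≤ M` is LIVE): the colour entries `(c i, c′ i)` of the dressed coloured site kernels
`((Q′G′²Q′* ⊗ 1)_{L·L^K} + P_f(A′))⁻¹ − ((Q′G′²Q′* ⊗ 1)_{L^K} + P_c(Ā′))⁻¹`, `P = siteEntriesC (sitePertC … (G′ ⊗ 1) (pr₀ ∘ curvDressed(e^{η ad A})))`, satisfy `NE2PlusSite d′ p c₃₅` —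
§3 ∘ `ne2PlusSite_cSiteExOn_of_sizedLetters`. [cite: Balaban1985BackgroundPropagators, Thm 3.2 (3.48) p.398 + Thm 3.14 pp.426–427 (quantifier template), (3.35) p.396, (3.50)–(3.53) p.400, (3.63)–(3.67) pp.402–403 (mechanism); Balaban1984PropagatorsI, (1.45) p.26; King1986, p.664, Prop. 3.8 (3.71) p.664; CombesThomas1973, §II] -/
theorem ne2PlusSite_curvColSite (he : ∀ X Y : Matrix n n ℂ, traceForm X Y = e X ⬝ᵥ e Y) (hLodd : Odd L) (hL : 2 ≤ L) (ha : 0 < a) (c35 : ℝ) (d' : ℕ) (p : ℝ)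
    (c c' : KingVolIndex d → κ) :
    NE2PlusSite d' p c35
      (fun i : KingVolIndex d => (⟨opGeo (unitTorusGeoS L i.K (curvCube L i) i.Msz) (Tor (fine (L ^ i.K) (curvCube L i)) × κ) (liftBlk (blockOf (L ^ i.K) (curvCube L i)) κ),
        fineGeo (unitTorusGeoS L i.K (curvCube L i) i.Msz) (Tor (fine L (fine (L ^ i.K) (curvCube L i))) × κ)
          (liftBlk (blockOf (L ^ i.K) (curvCube L i) ∘ blockOf L (fine (L ^ i.K) (curvCube L i))) κ) 1,
        curvBgC L n i, curvBgF L n i, curvPairing L κ i⟩ : PairedInstance))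
      (cSiteExOn κ (fun i => curvCube L i) (fun i => i.K) (fun _ => 1) (fun i => i.Msz) (fun i => Tor (fine (L ^ i.K) (curvCube L i)) × κ)
        (fun i => liftBlk (blockOf (L ^ i.K) (curvCube L i)) κ)
        (fun i => fineGeo (unitTorusGeoS L i.K (curvCube L i) i.Msz) (Tor (fine L (fine (L ^ i.K) (curvCube L i))) × κ)
          (liftBlk (blockOf (L ^ i.K) (curvCube L i) ∘ blockOf L (fine (L ^ i.K) (curvCube L i))) κ) 1)
        (curvBgC L n) (curvBgF L n) a (curvPairing L κ) (curvPf L κ e a) (curvPc L κ e a) c c') := by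
  obtain ⟨δP, ζ, τ, a₁, hδP, hζ, hτ, ha₁, HP⟩ := curvSite_letters (d := d) L κ e a he hLodd hL ha c35
  exact ne2PlusSite_cSiteExOn_of_sizedLetters (L := L) (I := KingVolIndex d) κ (fun i => curvCube L i) (fun i => i.K) (fun _ => 1) (fun i => i.Msz)
    (fun i => Tor (fine (L ^ i.K) (curvCube L i)) × κ) (fun i => liftBlk (blockOf (L ^ i.K) (curvCube L i)) κ)
    (fun i => fineGeo (unitTorusGeoS L i.K (curvCube L i) i.Msz) (Tor (fine L (fine (L ^ i.K) (curvCube L i))) × κ)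
      (liftBlk (blockOf (L ^ i.K) (curvCube L i) ∘ blockOf L (fine (L ^ i.K) (curvCube L i))) κ) 1)
    (curvBgC L n) (curvBgF L n) hLodd hL ha c35 d' p (mT := fun i => i.m) (fun _ _ => rfl) (fun i => i.one_le_K) (fun i => i.one_le_Msz)
    (curvPairing L κ) (curvPf L κ e a) (curvPc L κ e a) (γP := 1 / 4) (by norm_num) ⟨δP, ζ, τ, a₁, hδP, hζ, hτ, ha₁, HP⟩ c c'

omit [DecidableEq κ] in
/-- THE SIZE GUARD IS LIVE on this family: the fine instance's [B9] size parameter is the index's `M_sz` (`≥ 1`, unbounded over `KingVolIndex`). [folklore] -/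
theorem curvInstance_gf_M (i : KingVolIndex d) :
    (fineGeo (unitTorusGeoS L i.K (curvCube L i) i.Msz) (Tor (fine L (fine (L ^ i.K) (curvCube L i))) × κ)
      (liftBlk (blockOf (L ^ i.K) (curvCube L i) ∘ blockOf L (fine (L ^ i.K) (curvCube L i))) κ) 1).M = i.Msz := rfl

end Socket

end Summit.QuantumFields.YangMills.BalabanUVNodes.N15.SiteLayerBg

end
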